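import Summits.CriticalPhenomena.CardyFormulaZ2.Theorems.CardyUSTContinuationUniformAnalyticExtensionStubZeroFreeNonCrossingParity
import Summits.CriticalPhenomena.CardyFormulaZ2.Theorems.CardyComplexConeEdgePrecompactUFRSRectLatticeBox
import Literature.Probability.Percolation.QuadCrossingSquareModel
import HarnessLib

/-!
# An edge of `Ω_δ` inside a discrete arc, for axis-parallel rectangles — the geometric input of the
# parity package (stub `stub_zeroFreeNonCrossing`, line `registered`, skeleton v6 of the crux
# `UniformAnalyticExtension`, stmt-CriticalPhenomena-6047, route `CardyUSTContinuation`)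

Companion of `…StubZeroFreeNonCrossingParity.lean`, whose tightness theorems
(`zeroFreeNonCrossing_rho_le`, `zeroFreeNonCrossing_crossing_rho_le_of_frequently_adj`: every
witness `ρ` of `stub_zeroFreeNonCrossing` / `stub_zeroFreeCrossing` at `(R, t₁)` has `ρ ≤ 1 + t₁`)
take as a hypothesis that for arbitrarily small `δ > 0` the discrete domain
`Ω_δ = domainSubgraph R.carrier δ` has an edge with both endpoints in ONE discrete arc
(`rectArc R δ 0` or `rectArc R δ 2`).  That hypothesis fails for some conformal rectangles (the
diamond `{|x| + |y| < 1}`: its discrete boundary `{|i| + |j| = m}` spans no lattice edge), and here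
it is PROVED, for all small `δ`, for the axis-parallel rectangles `Percolation.rectQuad x₀ x₁ y₀ y₁`
(corners marked; arc `0` = bottom side):

* `zeroFreeNonCrossing_mem_discreteArc_rectQuad`: for `δ > 0` with `2δ ≤ y₁ − y₀`, the lowest-row
  box site `(i, ⌊y₀/δ⌋ + 1)` of a column with `x₀ + δ ≤ δ i ≤ x₁ − δ` is a discrete boundary vertex
  in the discrete arc of the bottom side (within `δ` of it, at distance `≥ δ` from the other sides;
  the lattice box is the whole discrete domain by `meshDomain_rect`);
* `zeroFreeNonCrossing_exists_adj_discreteArc_rectQuad`,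
  `zeroFreeNonCrossing_eventually_adj_rectArc_rectQuad`: two such adjacent sites exist once
  `4δ ≤ x₁ − x₀`, hence for all small `δ > 0`;
* consequences (UNCONDITIONAL for rectangles):
  `zeroFreeNonCrossing_eventually_aeval_neg_one_rectQuad` (`N_δ(−1) = 0 = Z_δ(−1)`, so
  `N^c_δ(−1) = 0`, for all small `δ`), `zeroFreeNonCrossing_crossing_rho_le_rectQuad` and the
  registered sub-goal `zeroFreeNonCrossing_rho_le_rectQuad` (`ρ ≤ 1 + t₁` for every witness of
  either sibling stub on a rectangle).
-/

noncomputable section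

open Filter Topology Set Polynomial Metric
open Literature.Probability.LatticeModels
open Literature.Probability.RandomPlanarGeometry (ConformalRectangle)

namespace Summit.CriticalPhenomena.CardyFormulaZ2.Cruxes.UniformAnalyticExtension.Birth

section Rect

open Summit.CriticalPhenomena.CardyFormulaZ2.Cruxes.EdgePrecompact.QkzStripBoundaryArm
open Literature.Probability.Percolation

variable {x₀ x₁ y₀ y₁ : ℝ} (hx : x₀ < x₁) (hy : y₀ < y₁)

/-- **A bottom-row vertex of the lattice box lies in the discrete arc of the bottom side.** For
the axis-parallel rectangle `(x₀, x₁) × (y₀, y₁)` at mesh `δ > 0` with `2δ ≤ y₁ − y₀`, the site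
`(i, j₀)` of the lowest row `j₀ = ⌊y₀/δ⌋ + 1` in a column with `x₀ + δ ≤ δ i ≤ x₁ − δ` is a vertex
of `Ω_δ`, a discrete boundary vertex (its lower neighbour is outside), and belongs to the discrete
arc of the bottom side `(ab) = arc 0` (it is within `δ j₀ − y₀ ≤ δ` of the bottom side and at
distance `≥ δ` from the three other sides). [folklore] -/
theorem zeroFreeNonCrossing_mem_discreteArc_rectQuad {δ : ℝ} (hδ : 0 < δ) (hδy : 2 * δ ≤ y₁ - y₀)
    {i : ℤ} (h1 : x₀ + δ ≤ δ * i) (h2 : δ * i + δ ≤ x₁) :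
    (![i, ⌊y₀ / δ⌋ + 1] : Site 2) ∈ meshVertices (rectQuad x₀ x₁ y₀ y₁ hx hy).carrier δ ∧
      (![i, ⌊y₀ / δ⌋ + 1] : Site 2) ∈ discreteArc (rectQuad x₀ x₁ y₀ y₁ hx hy).carrier δ
        ((rectQuad x₀ x₁ y₀ y₁ hx hy).arc 0) := by
  set j₀ : ℤ := ⌊y₀ / δ⌋ + 1 with hj₀
  have hj₁ : y₀ < δ * j₀ := by
    have h := Int.lt_floor_add_one (y₀ / δ)
    rw [div_lt_iff₀ hδ] at h
    push_cast [hj₀]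
    linarith
  have hj₂ : δ * j₀ ≤ y₀ + δ := by
    have h := Int.floor_le (y₀ / δ)
    rw [le_div_iff₀ hδ] at h
    push_cast [hj₀]
    linarith
  have hcar := rectQuad_carrier hx hy
  have memV : ∀ a b : ℤ, (![a, b] : Site 2) ∈ meshVertices (rectQuad x₀ x₁ y₀ y₁ hx hy).carrier δ ↔
      (x₀ < δ * a ∧ δ * a < x₁) ∧ (y₀ < δ * b ∧ δ * b < y₁) := fun a b => by
    rw [hcar, mem_meshVertices_rect]; simp
  have hV : (![i, j₀] : Site 2) ∈ meshVertices (rectQuad x₀ x₁ y₀ y₁ hx hy).carrier δ :=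
    (memV i j₀).2 ⟨⟨by linarith, by linarith⟩, hj₁, by linarith⟩
  refine ⟨hV, ?_⟩
  have hD : meshDomain (rectQuad x₀ x₁ y₀ y₁ hx hy).carrier δ =
      meshVertices (rectQuad x₀ x₁ y₀ y₁ hx hy).carrier δ := by
    rw [hcar]; exact meshDomain_rect hδ
  -- a discrete boundary vertex: the lower neighbour `(i, j₀ - 1)` is outside the box
  have hB : (![i, j₀] : Site 2) ∈ meshBoundary (rectQuad x₀ x₁ y₀ y₁ hx hy).carrier δ := by
    refine mem_meshBoundary_iff.2 ⟨hD ▸ hV, ![i, j₀ - 1], ?_, fun had => ?_⟩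
    · have := adj_right_or_up i (j₀ - 1) i j₀ (Or.inr ⟨rfl, by ring⟩)
      exact this.symm
    · have hmem := (discreteDomainGraph_adj_iff.1 had).2.2
      rw [hD, memV] at hmem
      have := hmem.2.1
      push_cast at this
      linarith
  refine mem_discreteArc_iff.2 ⟨hB, ?_⟩
  have hre : (meshPoint δ ![i, j₀]).re = δ * i := by simp
  have him : (meshPoint δ ![i, j₀]).im = δ * j₀ := by simp
  -- distance to the bottom side: at most `δ j₀ - y₀ ≤ δ`
  have hle : infDist (meshPoint δ ![i, j₀]) ((rectQuad x₀ x₁ y₀ y₁ hx hy).arc 0) ≤ δ := by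
    have hmem : (⟨δ * i, y₀⟩ : ℂ) ∈ (rectQuad x₀ x₁ y₀ y₁ hx hy).arc 0 :=
      (mem_rectQuad_arc_zero hx hy).2 ⟨rfl, by simp only; constructor <;> linarith⟩
    refine (infDist_le_dist_of_mem hmem).trans ?_
    rw [Complex.dist_of_re_eq (by rw [hre]), him, Real.dist_eq, abs_of_pos (by simp only; linarith)]
    simp only
    linarith
  -- distance to the rest of the boundary: at least `δ`
  have hne : (frontier (rectQuad x₀ x₁ y₀ y₁ hx hy).carrier \
      (rectQuad x₀ x₁ y₀ y₁ hx hy).arc 0).Nonempty :=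
    (frontier_diff_arc_zero_union_two_nonempty _).mono
      (Set.sdiff_subset_sdiff_right subset_union_left)
  refine hle.trans ((le_infDist hne).2 fun w hw => ?_)
  have hwf := hw.1
  rw [(rectQuad x₀ x₁ y₀ y₁ hx hy).isOpen.frontier_eq] at hwf
  obtain ⟨⟨hr0, hr1⟩, hm0, hm1⟩ := (mem_closure_rectQuad_carrier hx hy).1 hwf.1
  have hwc : ¬ (w.re ∈ Set.Ioo x₀ x₁ ∧ w.im ∈ Set.Ioo y₀ y₁) := fun h =>
    hwf.2 ((mem_rectQuad_carrier hx hy).2 h)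
  have key : δ ≤ |δ * i - w.re| ∨ δ ≤ |δ * j₀ - w.im| := by
    rcases hr0.eq_or_lt with h | h
    · exact Or.inl (le_abs.2 (Or.inl (by rw [← h]; linarith)))
    rcases hr1.eq_or_lt with h' | h'
    · exact Or.inl (le_abs.2 (Or.inr (by rw [h']; linarith)))
    rcases hm1.eq_or_lt with h'' | h''
    · exact Or.inr (le_abs.2 (Or.inr (by rw [h'']; linarith)))
    exfalso
    refine hw.2 ((mem_rectQuad_arc_zero hx hy).2
      ⟨le_antisymm (not_lt.1 fun hlt => hwc ⟨⟨h, h'⟩, hlt, h''⟩) hm0, hr0, hr1⟩)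
  rw [Complex.dist_eq]
  rcases key with h | h
  · refine h.trans ?_
    rw [← hre, ← Complex.sub_re]
    exact Complex.abs_re_le_norm _
  · refine h.trans ?_
    rw [← him, ← Complex.sub_im]
    exact Complex.abs_im_le_norm _

/-- **(P2) for rectangles: an edge of `Ω_δ` inside the discrete arc of the bottom side.** For the
axis-parallel rectangle `(x₀, x₁) × (y₀, y₁)` (a conformal rectangle with the corners marked,
`rectQuad`) and every mesh `δ > 0` with `4δ ≤ x₁ − x₀`, `2δ ≤ y₁ − y₀`, the two lowest-row sites of
the columns `i₀ = ⌊x₀/δ⌋ + 2` and `i₀ + 1` are adjacent in `Ω_δ` and both lie in the discrete arc of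
`(ab)`. [folklore] -/
theorem zeroFreeNonCrossing_exists_adj_discreteArc_rectQuad {δ : ℝ} (hδ : 0 < δ)
    (hδx : 4 * δ ≤ x₁ - x₀) (hδy : 2 * δ ≤ y₁ - y₀) :
    ∃ v v' : Site 2, (discreteDomainGraph (rectQuad x₀ x₁ y₀ y₁ hx hy).carrier δ).Adj v v' ∧
      v ∈ discreteArc (rectQuad x₀ x₁ y₀ y₁ hx hy).carrier δ
        ((rectQuad x₀ x₁ y₀ y₁ hx hy).arc 0) ∧
      v' ∈ discreteArc (rectQuad x₀ x₁ y₀ y₁ hx hy).carrier δ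
        ((rectQuad x₀ x₁ y₀ y₁ hx hy).arc 0) := by
  set i₀ : ℤ := ⌊x₀ / δ⌋ + 2 with hi₀
  have hi₁ : x₀ + δ < δ * i₀ := by
    have h := Int.lt_floor_add_one (x₀ / δ)
    rw [div_lt_iff₀ hδ] at h
    push_cast [hi₀]
    nlinarith
  have hi₂ : δ * i₀ ≤ x₀ + 2 * δ := by
    have h := Int.floor_le (x₀ / δ)
    rw [le_div_iff₀ hδ] at h
    push_cast [hi₀]
    linarith
  obtain ⟨hV, hA⟩ := zeroFreeNonCrossing_mem_discreteArc_rectQuad hx hy hδ hδy (i := i₀) hi₁.le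
    (by linarith)
  obtain ⟨hV', hA'⟩ := zeroFreeNonCrossing_mem_discreteArc_rectQuad hx hy hδ hδy (i := i₀ + 1)
    (by push_cast; linarith) (by push_cast; linarith)
  refine ⟨_, _, ?_, hA, hA'⟩
  rw [rectQuad_carrier hx hy] at hV hV' ⊢
  exact (discreteDomainGraph_adj_rect hδ).2
    ⟨adj_right_or_up i₀ (⌊y₀ / δ⌋ + 1) (i₀ + 1) (⌊y₀ / δ⌋ + 1) (Or.inl ⟨rfl, rfl⟩), hV, hV'⟩

/-- **(P2) for rectangles, eventually in `δ`, on the vertex type of `Ω_δ`.** For the conformal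
rectangle `rectQuad x₀ x₁ y₀ y₁`, for all small `δ > 0` the graph `domainSubgraph` has an edge with
both endpoints in `rectArc _ δ 0`. [folklore] -/
theorem zeroFreeNonCrossing_eventually_adj_rectArc_rectQuad :
    ∀ᶠ δ in 𝓝[>] (0:ℝ), ∃ x y : meshDomain (rectQuad x₀ x₁ y₀ y₁ hx hy).carrier δ,
      (domainSubgraph (rectQuad x₀ x₁ y₀ y₁ hx hy).carrier δ).Adj x y ∧
        (x ∈ rectArc (rectQuad x₀ x₁ y₀ y₁ hx hy) δ 0 ∧
            y ∈ rectArc (rectQuad x₀ x₁ y₀ y₁ hx hy) δ 0 ∨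
          x ∈ rectArc (rectQuad x₀ x₁ y₀ y₁ hx hy) δ 2 ∧
            y ∈ rectArc (rectQuad x₀ x₁ y₀ y₁ hx hy) δ 2) := by
  have hm : 0 < min ((x₁ - x₀) / 4) ((y₁ - y₀) / 2) := lt_min (by linarith) (by linarith)
  filter_upwards [Ioo_mem_nhdsGT hm] with δ hδ
  have hδx : 4 * δ ≤ x₁ - x₀ := by linarith [hδ.2.le.trans (min_le_left _ _)]
  have hδy : 2 * δ ≤ y₁ - y₀ := by linarith [hδ.2.le.trans (min_le_right _ _)]
  obtain ⟨v, v', hvv', hv, hv'⟩ :=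
    zeroFreeNonCrossing_exists_adj_discreteArc_rectQuad hx hy hδ.1 hδx hδy
  obtain ⟨-, hvm, hvm'⟩ := discreteDomainGraph_adj_iff.1 hvv'
  refine ⟨⟨v, hvm⟩, ⟨v', hvm'⟩, ?_, Or.inl ⟨hv, hv'⟩⟩
  rw [domainSubgraph, SimpleGraph.comap_adj]
  exact hvv'

/-- **`N_δ(−1) = 0` for rectangles, for all small meshes** (both wirings). [folklore] -/
theorem zeroFreeNonCrossing_eventually_aeval_neg_one_rectQuad (w : ArcWiring) :
    ∀ᶠ δ in 𝓝[>] (0:ℝ),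
      aeval (-1 : ℂ) (fkTwoArcCrossingPolynomial (rectQuad x₀ x₁ y₀ y₁ hx hy) δ w) = 0 ∧
      aeval (-1 : ℂ) (fkTwoArcCrossingPolynomial (rectQuad x₀ x₁ y₀ y₁ hx hy) δ w) =
        aeval (-1 : ℂ) (fkTwoArcPartitionPolynomials (rectQuad x₀ x₁ y₀ y₁ hx hy) δ w) := by
  filter_upwards [zeroFreeNonCrossing_eventually_adj_rectArc_rectQuad hx hy, self_mem_nhdsWithin]
    with δ ⟨x, y, hxy, hA⟩ hδ
  exact ⟨zeroFreeNonCrossing_aeval_neg_one_crossing_of_adj _ hδ hxy hA w,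
    zeroFreeNonCrossing_aeval_neg_one_eq_of_adj _ hδ hxy hA w⟩

/-- **Tightness of `stub_zeroFreeCrossing` at `t = −1` for rectangles (unconditional).** Every
witness `ρ` of the conclusion of `stub_zeroFreeCrossing` for `rectQuad x₀ x₁ y₀ y₁` at `t₁`,
`0 < t₁ ≤ 1`, satisfies `ρ ≤ 1 + t₁`. [folklore] -/
theorem zeroFreeNonCrossing_crossing_rho_le_rectQuad {t₁ ρ : ℝ} (ht₀ : 0 < t₁) (ht₁ : t₁ ≤ 1)
    (h : ∀ᶠ δ in 𝓝[>] (0:ℝ), ∀ z ∈ thickening ρ (((↑) : ℝ → ℂ) '' Set.Icc t₁ 1),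
      aeval z (fkTwoArcCrossingPolynomial (rectQuad x₀ x₁ y₀ y₁ hx hy) δ ArcWiring.joint) ≠ 0) :
    ρ ≤ 1 + t₁ :=
  zeroFreeNonCrossing_crossing_rho_le_of_frequently_adj _ ht₀ ht₁
    (zeroFreeNonCrossing_eventually_adj_rectArc_rectQuad hx hy).frequently h

end Rect

/-- **Registered sub-goal: tightness of `stub_zeroFreeNonCrossing` at `t = −1` for rectangles
(unconditional).** For every axis-parallel rectangle `rectQuad x₀ x₁ y₀ y₁`, `t₁ ∈ (0,1)` and `ρ`:
if `N_δ(z) ≠ Z_δ(z)` on the complex `ρ`-neighbourhood of `[t₁, 1]` for all small `δ > 0` (the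
conclusion of the stub with witness `ρ`), then `ρ ≤ 1 + t₁` — the neighbourhood cannot reach
`t = −1`, where `N_δ = Z_δ` (`= 0`) for all small `δ`. [folklore] -/
theorem zeroFreeNonCrossing_rho_le_rectQuad :
    ∀ (x₀ x₁ y₀ y₁ : ℝ) (hx : x₀ < x₁) (hy : y₀ < y₁), ∀ t₁ ∈ Set.Ioo (0:ℝ) 1, ∀ ρ : ℝ,
      (∀ᶠ δ in 𝓝[>] (0:ℝ), ∀ z ∈ thickening ρ (((↑) : ℝ → ℂ) '' Set.Icc t₁ 1),
        aeval z (fkTwoArcCrossingPolynomial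
            (Literature.Probability.Percolation.rectQuad x₀ x₁ y₀ y₁ hx hy) δ ArcWiring.joint) ≠
          aeval z (fkTwoArcPartitionPolynomials
            (Literature.Probability.Percolation.rectQuad x₀ x₁ y₀ y₁ hx hy) δ ArcWiring.joint)) →
      ρ ≤ 1 + t₁ :=
  fun _ _ _ _ hx hy _ ht₁ _ h => zeroFreeNonCrossing_rho_le_of_frequently_adj _ ht₁.1 ht₁.2.le
    (zeroFreeNonCrossing_eventually_adj_rectArc_rectQuad hx hy).frequently h

end Summit.CriticalPhenomena.CardyFormulaZ2.Cruxes.UniformAnalyticExtension.Birth
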